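import Mathlib.Algebra.CubicDiscriminant
import Literature.NumberTheory.EllipticCurves.MazurTorsion
import Literature.NumberTheory.EllipticCurves.TwoDescent
import Literature.NumberTheory.EllipticCurves.DivisionPolynomialTorsion
import HarnessLib

/-!
# Kubert (1976), no `ℤ/2ℤ × ℤ/12ℤ` in `E(ℚ)`: reduction to the rational points of `X₀(24) = 24A1`

Topic `NumberTheory/EllipticCurves`; sibling of `Literature.NumberTheory.EllipticCurves.MazurTorsion`,
whose named fact `Literature.BSD.Kubert1976_no_two_twelve W` (D. S. Kubert, *Universal bounds on the
torsion of elliptic curves*, Proc. London Math. Soc. (3) 33 (1976) 193–237, Ch. IV: the modular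
curve `X₁(2,12)` has only cuspidal rational points; quoted by Mazur 1977, Ch. III §5, p. 156)
says: for an elliptic curve `E/ℚ`, there is no injective homomorphism `ℤ/2ℤ × ℤ/12ℤ → E(ℚ)`.
It is one of the two Kubert leaves of the proved assembly `Literature.NumberTheory.EllipticCurves.mazur_torsion_of_leaves`.

This file **reduces** that fact, by an elementary and fully proved argument, to one line of
Cremona's tables — the named fact `Literature.NumberTheory.EllipticCurves.Cremona1997_points_24A1`: the elliptic curve
`24A1 : y² = x³ - x² - 4x + 4` (`= X₀(24)`) has exactly the eight rational points `O`,
`(1, 0), (2, 0), (-2, 0), (0, ±2), (4, ±6)` (Cremona, *Algorithms for Modular Elliptic Curves*,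
Table 1, `N = 24`, curve `A1`: `r = 0`, `|T| = 8`) — and proves
`Kubert1976_no_two_twelve_of_points_24A1 : Cremona1997_points_24A1 → Kubert1976_no_two_twelve W`.
The discharge of `Cremona1997_points_24A1` (complete `2`-descent, the tree's Mordell–Weil
theorem, reduction modulo `5` and `7`) is the business of the sibling `…Proofs` file.

## The argument (all proved here)

Let `f : ℤ/2ℤ × ℤ/12ℤ → E(F)` be injective, `F` a field of characteristic `0`
(`KubertTwoTwelve.exists_quartic_of_injective`).
1. `T₁ = f(0,6)`, `T₂ = f(1,0)`, `T₃ = f(1,6)` are three distinct affine `2`-torsion points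
   `(xᵢ, yᵢ)`; their abscissae are distinct roots of the `2`-division cubic
   `Ψ₂Sq = 4X³ + b₂X² + 2b₄X + b₆` (`ψ₂ = 2y + a₁x + a₃ = 0` on them, and `ψ₂² = Ψ₂Sq` on the
   curve), so `Ψ₂Sq = 4(X - x₁)(X - x₂)(X - x₃)` — the hypothesis `SplitTwoTorsion W x₁ x₂ x₃` of
   the tree's complete `2`-descent (`TwoDescent.lean`) (`splitTwoTorsion_of_two_smul`, via
   Mathlib's `Cubic.*_eq_three_roots`).
2. `T₁ = 2R` with `R = f(0,3)`. The tree's `2`-descent map `δ = (δ₁, δ₂) : E(F) → (Fˣ/Fˣ²)²` is a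
   homomorphism into a group of exponent `2`, so `δ(T₁) = δ(R)² = 1`; but `δ₂(T₁)` is the class of
   `x₁ - x₂` (and, after swapping `e₂, e₃`, of `x₁ - x₃`). Hence `x₁ - x₂ = r²`, `x₁ - x₃ = s²`
   (`exists_sq_of_add_self_eq`; the easy half of the halving criterion, Knapp Thm. 4.2).
3. `P₃ = f(0,4) = (x, y)` has order `3`, so `Ψ₃(x) = 0` (tree `three_smul_some_eq_zero_iff`), and
   with `b₂, b₄, b₆, b₈` expressed through `x₁, r, s` (`eval_Ψ₃_of_splitTwoTorsion`), `p = x - x₁`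
   satisfies Kubert's quartic `3p⁴ + 4(r² + s²)p³ + 6r²s²p² - r⁴s⁴ = 0`, `rs ≠ 0`, `r² ≠ s²`
   (at `s = 1` a plane model of `X₁(2,12)`: the curve `y² = x(x + r²)(x + 1)` carries
   `ℤ/2ℤ × ℤ/4ℤ`, and `p` is the abscissa of a rational `3`-division point).
4. Over `ℚ` (`exists_point_of_quartic`): the quartic is quadratic in `r²` with discriminant
   `16p³(p + s²)³`, so `w = (s⁴r² - 2p³ - 3s²p²)/(2p(p + s²))` has `w² = p(p + s²)`, and
   `(x, y) = (2w/p, 2rs(w - p)/p²)` lies on `24A1 : y² = x³ - x² - 4x + 4` with `y ≠ 0`,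
   `x ∉ {0, 4}` (polynomial certificates found with Sage, checked by `linear_combination`; the
   excluded values correspond exactly to the degenerations `rs = 0`, `r² = s²`, using
   `5s² + 27r² > 0` over `ℚ`). Such a point is none of the eight rational points of `24A1`.

Modular interpretation (not used in the proofs): `(E, ℤ/2 × ℤ/4 ⊂ E(ℚ), rational 3-division
point)` is a non-cuspidal point of `X₁(2,12) ≅ X_Δ(24) → X₀(24)`, and `X₀(24) = 24A1` has only its
eight cusps as rational points; equivalently (Fermat, Euler 1780) four squares in arithmetic
progression are trivial.

## References

* [Kubert1976] D. S. Kubert, *Universal bounds on the torsion of elliptic curves*, Proc. London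
  Math. Soc. (3) 33 (1976) 193–237, Ch. IV. (The PDF held in the literature store under this
  paper's DOI is Kubert's 1979 *Compositio* sequel of the same title; the 1976 paper itself has
  been requested; the statement reduced here is the one vendored in `MazurTorsion.lean`.)
* [Mazur1977] B. Mazur, *Modular curves and the Eisenstein ideal*, Publ. Math. IHÉS 47 (1977),
  Ch. III §5, p. 156 ("Kubert has shown ([27], chap. IV) …").
* [CremonaAlgorithms1997] J. E. Cremona, *Algorithms for Modular Elliptic Curves*, 2nd ed., CUP
  1997: Table 1, `N = 24 = 2³·3` (1 isogeny class), curve `A1 = [0, -1, 0, -4, 4]`, `r = 0`,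
  `|T| = 8` (held PDF p. 101; table legend p. 96).
* [Knapp1993] A. W. Knapp, *Elliptic Curves*, Princeton 1992, Thm. 4.2 (halving criterion).
* [SilvermanAEC2009] J. H. Silverman, *The Arithmetic of Elliptic Curves*, 2nd ed., Prop. X.1.4
  (complete `2`-descent), Exercise 3.7 (division polynomials).

## Design

* The reduction is proved for a Weierstrass curve over any field `F` of characteristic `0` with
  `[DecidableEq F]` (the convention of `TwoDescent.lean` and `DivisionPolynomialTorsion.lean`, so
  that at `F = ℚ` the group law is literally the one in `Kubert1976_no_two_twelve`).
* `Cremona1997_points_24A1` is stated on affine coordinates (every rational solution of the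
  Weierstrass equation of `curve24A1 = ⟨0, -1, 0, -4, 4⟩` is one of seven listed pairs), which is
  equivalent to `#E(ℚ) = 8` given that the listed points are rational points
  (`equation_curve24A1_of_mem`).
* Helper lemmas live in `namespace Literature.BSD.KubertTwoTwelve`; the named fact, the curve and the
  assembly in `namespace Literature.BSD`, next to `Kubert1976_no_two_twelve`.
-/

noncomputable section

open Polynomial

namespace Literature.NumberTheory.EllipticCurves.KubertTwoTwelve

open WeierstrassCurve WeierstrassCurve.Affine WeierstrassCurve.Affine.Point

section Generic

variable {F : Type*} [Field F] [DecidableEq F] {W : Affine F}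

omit [DecidableEq F] in
/-- A non-zero point of a Weierstrass curve is an affine point `(x, y)`. [folklore] -/
theorem exists_eq_some_of_ne_zero {P : W.Point} (hP : P ≠ 0) :
    ∃ (x y : F) (h : W.Nonsingular x y), P = .some x y h := by
  rcases P with _ | ⟨x, y, h⟩
  · exact absurd rfl hP
  · exact ⟨_, _, h, rfl⟩

/-- An affine `2`-torsion point `(x, y)` is its own negative: `y = -y - a₁x - a₃`
(Silverman, *AEC*, Group Law Algorithm III.2.3). [folklore] -/
theorem eq_negY_of_two_smul {x y : F} {h : W.Nonsingular x y}
    (h2 : (2 : ℤ) • (Point.some x y h : W.Point) = 0) : y = W.negY x y := by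
  rw [two_zsmul, add_eq_zero_iff_eq_neg, neg_some, some.injEq] at h2
  exact h2.2

/-- The abscissa of an affine `2`-torsion point is a root of the `2`-division cubic
`Ψ₂Sq = 4x³ + b₂x² + 2b₄x + b₆` (`ψ₂ = 2y + a₁x + a₃ = 0` and `ψ₂² = Ψ₂Sq` on the curve;
Silverman, *AEC*, Exercise 3.7). [folklore] -/
theorem eval_Ψ₂Sq_eq_zero_of_two_smul {x y : F} {h : W.Nonsingular x y}
    (h2 : (2 : ℤ) • (Point.some x y h : W.Point) = 0) : W.Ψ₂Sq.eval x = 0 := by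
  have hψ := (two_smul_some_eq_zero_iff h).mp h2
  rw [ψ_two, ψ₂, evalEval_polynomialY] at hψ
  have heq := (equation_iff x y).mp h.1
  simp only [Ψ₂Sq, eval_add, eval_mul, eval_C, eval_pow, eval_X, b₂, b₄, b₆]
  linear_combination (2 * y + W.a₁ * x + W.a₃) * hψ - 4 * heq

/-- Distinct affine `2`-torsion points have distinct abscissae (two points with the same `x` are
equal or opposite, and a `2`-torsion point is its own opposite). [folklore] -/
theorem X_ne_of_two_smul {x₁ y₁ x₂ y₂ : F} {h₁ : W.Nonsingular x₁ y₁} {h₂ : W.Nonsingular x₂ y₂}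
    (h2 : (2 : ℤ) • (Point.some x₁ y₁ h₁ : W.Point) = 0)
    (hne : (Point.some x₁ y₁ h₁ : W.Point) ≠ .some x₂ y₂ h₂) : x₁ ≠ x₂ := by
  intro hx
  have hy₁ := eq_negY_of_two_smul h2
  apply hne
  rcases Y_eq_of_X_eq h₂.1 h₁.1 hx.symm with hy | hy
  · subst hx; subst hy; rfl
  · subst hx
    rw [← hy₁] at hy
    subst hy; rfl

variable [CharZero F]

/-- **Full rational `2`-torsion gives `SplitTwoTorsion`.** If `(x₁, y₁), (x₂, y₂), (x₃, y₃)` are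
three distinct affine `2`-torsion points, then the `2`-division cubic is
`4(X - x₁)(X - x₂)(X - x₃)`, i.e. `W.SplitTwoTorsion x₁ x₂ x₃` (Silverman, *AEC*, Prop. X.1.4,
hypothesis `E[2] ⊆ E(K)`; proof: the `xᵢ` are three distinct roots of a cubic with leading
coefficient `4`). [folklore] -/
theorem splitTwoTorsion_of_two_smul {x₁ y₁ x₂ y₂ x₃ y₃ : F} {h₁ : W.Nonsingular x₁ y₁}
    {h₂ : W.Nonsingular x₂ y₂} {h₃ : W.Nonsingular x₃ y₃}
    (t₁ : (2 : ℤ) • (Point.some x₁ y₁ h₁ : W.Point) = 0)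
    (t₂ : (2 : ℤ) • (Point.some x₂ y₂ h₂ : W.Point) = 0)
    (t₃ : (2 : ℤ) • (Point.some x₃ y₃ h₃ : W.Point) = 0)
    (h₁₂ : (Point.some x₁ y₁ h₁ : W.Point) ≠ .some x₂ y₂ h₂)
    (h₁₃ : (Point.some x₁ y₁ h₁ : W.Point) ≠ .some x₃ y₃ h₃)
    (h₂₃ : (Point.some x₂ y₂ h₂ : W.Point) ≠ .some x₃ y₃ h₃) :
    W.SplitTwoTorsion x₁ x₂ x₃ := by
  have hx₁₂ := X_ne_of_two_smul t₁ h₁₂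
  have hx₁₃ := X_ne_of_two_smul t₁ h₁₃
  have hx₂₃ := X_ne_of_two_smul t₂ h₂₃
  set P : Cubic F := W.twoTorsionPolynomial with hPdef
  have ha : P.a ≠ 0 := by
    change (4 : F) ≠ 0
    norm_num
  have hP0 : P.toPoly ≠ 0 := Cubic.ne_zero_of_a_ne_zero ha
  have hroot : ∀ {x y : F} {h : W.Nonsingular x y},
      (2 : ℤ) • (Point.some x y h : W.Point) = 0 → x ∈ P.toPoly.roots := by
    intro x y h t
    rw [Polynomial.mem_roots hP0, IsRoot.def, ← Ψ₂Sq_eq]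
    exact eval_Ψ₂Sq_eq_zero_of_two_smul t
  have hnd : ({x₁, x₂, x₃} : Multiset F).Nodup := by
    simp only [Multiset.insert_eq_cons, Multiset.nodup_cons, Multiset.mem_cons,
      Multiset.mem_singleton, Multiset.nodup_singleton, and_true, not_or]
    exact ⟨⟨hx₁₂, hx₁₃⟩, hx₂₃⟩
  have hle : ({x₁, x₂, x₃} : Multiset F) ≤ P.toPoly.roots := by
    rw [Multiset.le_iff_subset hnd]
    intro x hx
    simp only [Multiset.insert_eq_cons, Multiset.mem_cons, Multiset.mem_singleton] at hx
    rcases hx with rfl | rfl | rfl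
    exacts [hroot t₁, hroot t₂, hroot t₃]
  have hcard : P.toPoly.roots.card ≤ ({x₁, x₂, x₃} : Multiset F).card := by
    refine (Polynomial.card_roots' _).trans ?_
    rw [Cubic.natDegree_of_a_ne_zero ha]
    simp
  have h3 : (Cubic.map (RingHom.id F) P).roots = {x₁, x₂, x₃} := by
    rw [Cubic.map_roots, Polynomial.map_id]
    exact (Multiset.eq_of_le_of_card_le hle hcard).symm
  have hb := Cubic.b_eq_three_roots ha h3
  have hc := Cubic.c_eq_three_roots ha h3
  have hd := Cubic.d_eq_three_roots ha h3
  simp only [RingHom.id_apply] at hb hc hd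
  change W.b₂ = 4 * _ at hb
  change 2 * W.b₄ = 4 * _ at hc
  change W.b₆ = 4 * _ at hd
  exact ⟨by rw [hb]; ring, by linear_combination (1 / 2 : F) * hc, by rw [hd]; ring⟩

/-- **Halving a `2`-torsion point forces squares** (the easy half of the halving criterion,
Knapp, *Elliptic Curves*, Thm. 4.2; Silverman, *AEC*, Prop. X.1.4): with rational `2`-torsion
`e₁, e₂, e₃`, if the `2`-torsion point `T₁ = (e₁, y₁)` is `2R` for a rational point `R`, then
`e₁ - e₂` and `e₁ - e₃` are squares. Proof: the complete `2`-descent map is a homomorphism to a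
group of exponent `2` (tree `twoDescentMap`), so `δ(T₁) = δ(R)² = 1`, and the components of
`δ(T₁)` at `e₂`, `e₃` are the classes of `e₁ - e₂`, `e₁ - e₃`. [cite: Knapp1993, Thm. 4.2] -/
theorem exists_sq_of_add_self_eq [W.IsElliptic] {e₁ e₂ e₃ : F} (h : W.SplitTwoTorsion e₁ e₂ e₃)
    {y₁ : F} {h₁ : W.Nonsingular e₁ y₁} (R : W.Point) (hR : R + R = .some e₁ y₁ h₁) :
    (∃ r : F, e₁ - e₂ = r ^ 2) ∧ (∃ s : F, e₁ - e₃ = s ^ 2) := by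
  have key : ∀ {e e' : F} (h' : W.SplitTwoTorsion e₁ e e'), ∃ r : F, e₁ - e = r ^ 2 := by
    intro e e' h'
    have hδ : twoDescentMap h' (R + R) = 0 := by
      rw [map_add, twoDescentMap_apply, ← ofMul_mul, Prod.mk_mul_mk, SqUnits.mul_self,
        SqUnits.mul_self]
      rfl
    rw [hR, twoDescentMap_apply, ofMul_eq_zero, Prod.mk_eq_one] at hδ
    have h2 := hδ.2
    rw [twoDescentComponent_some_of_ne h₁ h'.ne₁₂] at h2
    exact (sqClass_eq_one_iff (sub_ne_zero.mpr h'.ne₁₂)).mp h2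
  exact ⟨key h, key h.swap₂₃⟩

omit [DecidableEq F] in
/-- **The `3`-division polynomial in terms of the `2`-torsion.** With rational `2`-torsion
`e₁, e₂ = e₁ - r², e₃ = e₁ - s²` (so that, after `x ↦ x - e₁` and completing the square, the curve
is `y² = x(x + r²)(x + s²)`), `Ψ₃(e₁ + p) = 3p⁴ + 4(r² + s²)p³ + 6r²s²p² - r⁴s⁴`
(`Ψ₃ = 3x⁴ + b₂x³ + 3b₄x² + 3b₆x + b₈`, `4b₈ = b₂b₆ - b₄²`; Silverman, *AEC*, III.1 and
Exercise 3.7). [folklore] -/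
theorem eval_Ψ₃_of_splitTwoTorsion {e₁ r s : F} (h : W.SplitTwoTorsion e₁ (e₁ - r ^ 2) (e₁ - s ^ 2))
    (p : F) : W.Ψ₃.eval (e₁ + p) =
      3 * p ^ 4 + 4 * (r ^ 2 + s ^ 2) * p ^ 3 + 6 * r ^ 2 * s ^ 2 * p ^ 2 - r ^ 4 * s ^ 4 := by
  have hb := W.b_relation
  simp only [Ψ₃, eval_add, eval_mul, eval_pow, eval_C, eval_X, eval_ofNat]
  rw [h.b₂_eq, h.b₄_eq, h.b₆_eq] at hb ⊢
  linear_combination (1 / 4 : F) * hb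

/-- **From `ℤ/2ℤ × ℤ/12ℤ ↪ E(F)` to Kubert's quartic.** If `E(F)` (char. `0`) contains a subgroup
isomorphic to `ℤ/2ℤ × ℤ/12ℤ`, then there are `p, r, s ∈ F` with `rs ≠ 0`, `r² ≠ s²` and
`3p⁴ + 4(r² + s²)p³ + 6r²s²p² - r⁴s⁴ = 0`. Proof: with `P` of order `12` and `Q` of order `2`
outside `⟨P⟩`, the points `6P, Q, Q + 6P` are the full `2`-torsion (`SplitTwoTorsion` with
`e₁ = x(6P)`), `6P = 2(3P)` forces `e₁ - e₂ = r²`, `e₁ - e₃ = s²`, and `4P = (x₃, y₃)` has order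
`3`, so `Ψ₃(x₃) = 0`; put `p = x₃ - e₁`. (The quartic in `(p, r)` at `s = 1` is a model of the
modular curve `X₁(2,12)`; Kubert 1976, Ch. IV.) [folklore] -/
theorem exists_quartic_of_injective [W.IsElliptic] (f : ZMod 2 × ZMod 12 →+ W.Point)
    (hf : Function.Injective f) :
    ∃ p r s : F, r ≠ 0 ∧ s ≠ 0 ∧ r ^ 2 ≠ s ^ 2 ∧
      3 * p ^ 4 + 4 * (r ^ 2 + s ^ 2) * p ^ 3 + 6 * r ^ 2 * s ^ 2 * p ^ 2 - r ^ 4 * s ^ 4 = 0 := by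
  -- the five points
  have hne : ∀ {a : ZMod 2 × ZMod 12}, a ≠ 0 → f a ≠ 0 := fun ha h0 =>
    ha (hf (by rw [h0, f.map_zero]))
  have two : ∀ {a : ZMod 2 × ZMod 12}, (2 : ℤ) • a = 0 → (2 : ℤ) • f a = 0 := fun ha => by
    rw [← map_zsmul, ha, f.map_zero]
  obtain ⟨x₁, y₁, h₁, hT₁⟩ := exists_eq_some_of_ne_zero (hne (a := (0, 6)) (by decide))
  obtain ⟨x₂, y₂, h₂, hT₂⟩ := exists_eq_some_of_ne_zero (hne (a := (1, 0)) (by decide))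
  obtain ⟨x₃, y₃, h₃, hT₃⟩ := exists_eq_some_of_ne_zero (hne (a := (1, 6)) (by decide))
  obtain ⟨x, y, hxy, hP₃⟩ := exists_eq_some_of_ne_zero (hne (a := (0, 4)) (by decide))
  have t₁ : (2 : ℤ) • (Point.some x₁ y₁ h₁ : W.Point) = 0 := hT₁ ▸ two (by decide)
  have t₂ : (2 : ℤ) • (Point.some x₂ y₂ h₂ : W.Point) = 0 := hT₂ ▸ two (by decide)
  have t₃ : (2 : ℤ) • (Point.some x₃ y₃ h₃ : W.Point) = 0 := hT₃ ▸ two (by decide)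
  have h₁₂ : (Point.some x₁ y₁ h₁ : W.Point) ≠ .some x₂ y₂ h₂ := by
    rw [← hT₁, ← hT₂]; exact fun h => absurd (hf h) (by decide)
  have h₁₃ : (Point.some x₁ y₁ h₁ : W.Point) ≠ .some x₃ y₃ h₃ := by
    rw [← hT₁, ← hT₃]; exact fun h => absurd (hf h) (by decide)
  have h₂₃ : (Point.some x₂ y₂ h₂ : W.Point) ≠ .some x₃ y₃ h₃ := by
    rw [← hT₂, ← hT₃]; exact fun h => absurd (hf h) (by decide)
  have hsplit := splitTwoTorsion_of_two_smul t₁ t₂ t₃ h₁₂ h₁₃ h₂₃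
  -- `6P = 2 (3P)`
  have hR : f (0, 3) + f (0, 3) = .some x₁ y₁ h₁ := by
    rw [← map_add, ← hT₁, show ((0, 3) : ZMod 2 × ZMod 12) + (0, 3) = (0, 6) by decide]
  obtain ⟨⟨r, hr⟩, ⟨s, hs⟩⟩ := exists_sq_of_add_self_eq hsplit (f (0, 3)) hR
  have hr0 : r ≠ 0 := by
    rintro rfl
    exact hsplit.ne₁₂ (by linear_combination hr)
  have hs0 : s ≠ 0 := by
    rintro rfl
    exact hsplit.ne₁₃ (by linear_combination hs)
  have hrs : r ^ 2 ≠ s ^ 2 := fun e => hsplit.ne₂₃ (by linear_combination hs - hr - e)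
  have he₂ : x₂ = x₁ - r ^ 2 := by linear_combination -hr
  have he₃ : x₃ = x₁ - s ^ 2 := by linear_combination -hs
  rw [he₂, he₃] at hsplit
  -- the point of order `3`
  have hy : y ≠ W.negY x y := by
    intro hyy
    have h2 : (2 : ℤ) • (Point.some x y hxy : W.Point) = 0 := by
      rw [two_zsmul, add_eq_zero_iff_eq_neg, neg_some]
      congr
    rw [← hP₃, ← map_zsmul] at h2
    exact absurd (hf (h2.trans f.map_zero.symm)) (by decide)
  have h3 : (3 : ℤ) • (Point.some x y hxy : W.Point) = 0 := by
    rw [← hP₃, ← map_zsmul, show (3 : ℤ) • ((0, 4) : ZMod 2 × ZMod 12) = 0 by decide, f.map_zero]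
  have hΨ := (three_smul_some_eq_zero_iff hxy hy).mp h3
  rw [ψ_three, evalEval_C] at hΨ
  refine ⟨x - x₁, r, s, hr0, hs0, hrs, ?_⟩
  rw [← eval_Ψ₃_of_splitTwoTorsion hsplit, add_sub_cancel, hΨ]

end Generic

/-! ### Over `ℚ`: from Kubert's quartic to a rational point of `24A1` -/

section Rat

/-- **Kubert's quartic maps to `X₀(24) = 24A1`.** For `p, r, s ∈ ℚ` with `rs ≠ 0`, `r² ≠ s²`
and `3p⁴ + 4(r² + s²)p³ + 6r²s²p² - r⁴s⁴ = 0`, put `N = s⁴r² - 2p³ - 3s²p²`,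
`D = 2p(p + s²)`; then `N² = D² p (p + s²)` (the quartic is quadratic in `r²` with discriminant
`16p³(p + s²)³`), and `x = 2N/(pD)`, `y = 2rs(N - pD)/(p²D)` satisfy
`y² = x³ - x² - 4x + 4` with `y ≠ 0`, `x ≠ 0`, `x ≠ 4` (the polynomial identities were found
with a computer algebra system and are certified by `linear_combination`). An explicit
birational map from the model `Ψ₃(e₁ + p) = 0` of `X₁(2,12)` (Kubert 1976, Ch. IV) onto
Cremona's curve `24A1 : y² = x³ - x² - 4x + 4` minus its eight torsion points. [folklore] -/
theorem exists_point_of_quartic {p r s : ℚ} (hr : r ≠ 0) (hs : s ≠ 0) (hrs : r ^ 2 ≠ s ^ 2)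
    (hF : 3 * p ^ 4 + 4 * (r ^ 2 + s ^ 2) * p ^ 3 + 6 * r ^ 2 * s ^ 2 * p ^ 2 - r ^ 4 * s ^ 4 = 0) :
    ∃ x y : ℚ, y ^ 2 = x ^ 3 - x ^ 2 - 4 * x + 4 ∧ y ≠ 0 ∧ x ≠ 0 ∧ x ≠ 4 := by
  have hp : p ≠ 0 := by
    rintro rfl
    apply hr
    have : r ^ 4 * s ^ 4 = 0 := by linear_combination -hF
    simpa [hs] using this
  have hps : p + s ^ 2 ≠ 0 := by
    intro h0
    have hp' : p = -s ^ 2 := by linear_combination h0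
    rw [hp'] at hF
    have : (s ^ 2 * (s ^ 2 - r ^ 2)) ^ 2 = 0 := by linear_combination -hF
    have h' := pow_eq_zero_iff (n := 2) two_ne_zero |>.mp this
    rcases mul_eq_zero.mp h' with h' | h'
    · exact hs (pow_eq_zero_iff two_ne_zero |>.mp h')
    · exact hrs (by linear_combination -h')
  obtain ⟨N, hN⟩ : ∃ N : ℚ, N = s ^ 4 * r ^ 2 - 2 * p ^ 3 - 3 * s ^ 2 * p ^ 2 := ⟨_, rfl⟩
  obtain ⟨D, hD⟩ : ∃ D : ℚ, D = 2 * p * (p + s ^ 2) := ⟨_, rfl⟩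
  have hD0 : D ≠ 0 := hD ▸ mul_ne_zero (mul_ne_zero two_ne_zero hp) hps
  have key₁ : N ^ 2 = D ^ 2 * (p * (p + s ^ 2)) := by
    rw [hN, hD]; linear_combination (-s ^ 4) * hF
  have key₂ : 4 * r ^ 2 * s ^ 2 * (N - p * D) ^ 2 * D -
      (8 * N ^ 3 * p - 4 * N ^ 2 * p ^ 2 * D - 8 * N * p ^ 3 * D ^ 2 + 4 * p ^ 4 * D ^ 3) = 0 := by
    rw [hN, hD]
    linear_combination (8 * p ^ 2 * s ^ 2 * (-r ^ 2 * s ^ 4 + 5 * s ^ 2 * p ^ 2 + 4 * p ^ 3)) * hF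
  have hN0 : N ≠ 0 := by
    intro h0
    have : D ^ 2 * (p * (p + s ^ 2)) = 0 := by rw [← key₁, h0]; ring
    simp [hD0, hp, hps] at this
  have hNpD : N - p * D ≠ 0 := by
    intro h0
    have h1 : N = p * D := by linear_combination h0
    have h2 : D ^ 2 * p * s ^ 2 = 0 := by linear_combination (p * D + N) * h1 - key₁
    simp [hD0, hp, hs] at h2
  have hN2 : N ≠ 2 * p * D := by
    intro h1
    have h2 : D ^ 2 * p * (3 * p - s ^ 2) = 0 := by
      linear_combination key₁ - (N + 2 * p * D) * h1
    have h3 : s ^ 2 = 3 * p := by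
      have : 3 * p - s ^ 2 = 0 := by simpa [hD0, hp] using h2
      linear_combination -this
    -- with `s² = 3p` the quartic factors as `p² (3p - r²) (5p + 9r²)`
    have h4 : p ^ 2 * ((3 * p - r ^ 2) * (5 * p + 9 * r ^ 2)) = 0 := by
      linear_combination hF + (-4 * p ^ 3 - 6 * r ^ 2 * p ^ 2 + r ^ 4 * s ^ 2 + 3 * p * r ^ 4) * h3
    rcases mul_eq_zero.mp h4 with h5 | h5
    · exact hp (pow_eq_zero_iff two_ne_zero |>.mp h5)
    rcases mul_eq_zero.mp h5 with h6 | h6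
    · exact hrs (by linear_combination -h3 - h6)
    · have h7 : 5 * s ^ 2 + 27 * r ^ 2 = 0 := by linear_combination 5 * h3 + 3 * h6
      nlinarith [sq_nonneg s, sq_pos_of_ne_zero hr]
  have hpD : p * D ≠ 0 := mul_ne_zero hp hD0
  have hp2D : p ^ 2 * D ≠ 0 := mul_ne_zero (pow_ne_zero 2 hp) hD0
  refine ⟨2 * N / (p * D), 2 * r * s * (N - p * D) / (p ^ 2 * D), ?_, ?_, ?_, ?_⟩
  · have e : (2 * r * s * (N - p * D) / (p ^ 2 * D)) ^ 2 -
        ((2 * N / (p * D)) ^ 3 - (2 * N / (p * D)) ^ 2 - 4 * (2 * N / (p * D)) + 4) =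
        (4 * r ^ 2 * s ^ 2 * (N - p * D) ^ 2 * D -
          (8 * N ^ 3 * p - 4 * N ^ 2 * p ^ 2 * D - 8 * N * p ^ 3 * D ^ 2 + 4 * p ^ 4 * D ^ 3)) /
          (p ^ 4 * D ^ 3) := by
      field_simp
      ring
    rw [key₂, zero_div, sub_eq_zero] at e
    exact e
  · exact div_ne_zero (mul_ne_zero (mul_ne_zero (mul_ne_zero two_ne_zero hr) hs) hNpD) hp2D
  · exact div_ne_zero (mul_ne_zero two_ne_zero hN0) hpD
  · intro h4
    rw [div_eq_iff hpD] at h4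
    exact hN2 (by linear_combination h4 / 2)

end Rat

end Literature.NumberTheory.EllipticCurves.KubertTwoTwelve

/-! ### The curve `24A1 = X₀(24)`, the named fact, and the assembly -/

namespace Literature.NumberTheory.EllipticCurves

open WeierstrassCurve

/-- **Cremona's curve `24A1`**, `y² = x³ - x² - 4x + 4 = (x - 1)(x - 2)(x + 2)`
(`[a₁, a₂, a₃, a₄, a₆] = [0, -1, 0, -4, 4]`, conductor `24`, `Δ = 2⁸·3² = 2304`): the strong Weil
curve of conductor `24`, i.e. the modular curve `X₀(24)` (genus `1`). Cremona, *Algorithms for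
Modular Elliptic Curves*, 2nd ed., Table 1, `N = 24`, curve `A1`.
[cite: CremonaAlgorithms1997, Table 1, N = 24, curve A1] -/
def curve24A1 : WeierstrassCurve ℚ := ⟨0, -1, 0, -4, 4⟩

/-- `Δ(24A1) = 2304 = 2⁸ · 3²` (Cremona, Table 1, `N = 24`, `A1`: sign `+`, `ord_p Δ = 8, 2`).
[cite: CremonaAlgorithms1997, Table 1, N = 24, curve A1] -/
theorem curve24A1_Δ : curve24A1.Δ = 2304 := by
  norm_num [curve24A1, WeierstrassCurve.Δ, b₂, b₄, b₆, b₈]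

/-- `24A1` is an elliptic curve (`Δ = 2304 ≠ 0`). [cite: CremonaAlgorithms1997, Table 1, N = 24, curve A1] -/
theorem isElliptic_curve24A1 : curve24A1.IsElliptic :=
  ⟨by rw [curve24A1_Δ]; norm_num⟩

/-- The affine equation of `24A1`: `y² = x³ - x² - 4x + 4`. [cite: CremonaAlgorithms1997, Table 1, N = 24, curve A1] -/
theorem equation_curve24A1_iff (x y : ℚ) :
    curve24A1.toAffine.Equation x y ↔ y ^ 2 = x ^ 3 - x ^ 2 - 4 * x + 4 := by
  rw [Affine.equation_iff]
  simp only [curve24A1]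
  constructor <;> intro h <;> linear_combination h

/-- **Named fact (Cremona 1997, Table 1, curve `24A1`): the rational points of `24A1`.**
Cremona's Table 1 (held PDF p. 101; legend p. 96: column (3) the rank `r` of `E(ℚ)`, column (4)
the order `|T|` of its torsion subgroup) lists for `N = 24 = 2³·3` the curve
`A1 = [0, -1, 0, -4, 4]` with `r = 0` and `|T| = 8`; hence `E(ℚ) = T` has exactly eight
points. The eight points are exhibited here: `O`, the `2`-torsion `(1, 0), (2, 0), (-2, 0)`, and
the points `(0, ±2), (4, ±6)` of order `4` (so `T ≅ ℤ/2ℤ × ℤ/4ℤ`); that these are rational points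
is immediate, and the content of the table entry is that there are no others. Stated on affine
coordinates: every rational solution of `y² = x³ - x² - 4x + 4` is one of the seven affine
points listed. Classically this is Fermat's assertion, proved by Euler (1780), that four squares
in arithmetic progression are trivial, and it says that `X₀(24)(ℚ)` consists of its `8` cusps.
[cite: CremonaAlgorithms1997, Table 1, N = 24, curve A1 (r = 0, |T| = 8)] -/
def Cremona1997_points_24A1 : Prop :=
  ∀ x y : ℚ, curve24A1.toAffine.Equation x y →
    (y = 0 ∧ (x = 1 ∨ x = 2 ∨ x = -2)) ∨ (x = 0 ∧ (y = 2 ∨ y = -2)) ∨ (x = 4 ∧ (y = 6 ∨ y = -6))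

/-- Non-vacuity of `Cremona1997_points_24A1`: the seven listed affine points do lie on `24A1`.
[cite: CremonaAlgorithms1997, Table 1, N = 24, curve A1] -/
theorem equation_curve24A1_of_mem {x y : ℚ}
    (h : (y = 0 ∧ (x = 1 ∨ x = 2 ∨ x = -2)) ∨ (x = 0 ∧ (y = 2 ∨ y = -2)) ∨
      (x = 4 ∧ (y = 6 ∨ y = -6))) :
    curve24A1.toAffine.Equation x y := by
  rw [equation_curve24A1_iff]
  rcases h with ⟨rfl, rfl | rfl | rfl⟩ | ⟨rfl, rfl | rfl⟩ | ⟨rfl, rfl | rfl⟩ <;> norm_num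

/-- **Kubert (1976), no `ℤ/2ℤ × ℤ/12ℤ`, from the rational points of `X₀(24) = 24A1`.**
Granted Cremona's table entry `24A1: r = 0, |T| = 8` (`Cremona1997_points_24A1`), no elliptic
curve over `ℚ` has a subgroup `ℤ/2ℤ × ℤ/12ℤ` in `E(ℚ)` (`Kubert1976_no_two_twelve W`, Kubert 1976,
Ch. IV: `X₁(2,12)(ℚ)` is cuspidal; Mazur 1977, Ch. III §5, p. 156). Proof: such a subgroup yields
`p, r, s ∈ ℚ` on Kubert's quartic (`KubertTwoTwelve.exists_quartic_of_injective`), hence a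
rational point `(x, y)` of `24A1` with `y ≠ 0`, `x ∉ {0, 4}`
(`KubertTwoTwelve.exists_point_of_quartic`), which is none of the eight rational points.
[cite: Kubert1976, Ch. IV (X₁(2,12)); Mazur1977, Ch. III §5 p. 156] -/
theorem Kubert1976_no_two_twelve_of_points_24A1 (h24 : Cremona1997_points_24A1)
    (W : WeierstrassCurve ℚ) : Kubert1976_no_two_twelve W := by
  intro _ hf
  obtain ⟨f, hf⟩ := hf
  obtain ⟨p, r, s, hr, hs, hrs, hF⟩ :=
    KubertTwoTwelve.exists_quartic_of_injective (W := W.toAffine) f hf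
  obtain ⟨x, y, hxy, hy, hx0, hx4⟩ := KubertTwoTwelve.exists_point_of_quartic hr hs hrs hF
  rcases h24 x y ((equation_curve24A1_iff x y).mpr hxy) with ⟨h, -⟩ | ⟨h, -⟩ | ⟨h, -⟩
  exacts [hy h, hx0 h, hx4 h]

end Literature.NumberTheory.EllipticCurves

end
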